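import Summits.ResolutionOfSingularities.ResolutionOfSingularities.Theorems.PurelyInseparableDim4ScopeBlindCoatFamilies
import Literature.AlgebraicGeometry.Resolution.HasseSchmidtDiffEqDiffOp
import HarnessLib

/-!
# The MONOMIAL-COAT LEMMA: `x^m · U` with `|m| = q − 1` is OUT of coordinate scope when `U(x_T ↦ 0)` vanishes at the
# origin and no free coordinate divides it (`T ⊇ supp m`) — curve-free, any field (cell `res-dim4-pi`, scope column)

[OURS · counted 0 · frame bookkeeping] Nothing here is a statement about resolution of singularities.
Seat res-dim4-p-8 g3.  `…ScopeBlindCoat` (p676015) treated the coat `x_k^{q−1}·U`.  Blind leaves with a PRODUCT of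
coordinates in front occur too — res-dim4-p-6 g3's LOOP-D leaf `x₁x₄·(x₃² − x₂⁴)` at `q = 3` (bus 22:50:32Z, there by a
monomial curve).  Same mechanism, same proof, any monomial `x^m` of total degree `q − 1` supported in a set `T`:

* §1 `hasseDeriv_monomialCoat_mem`: for `|α| < q`, `D^{(α)}(x^m·U) ∈ (x_i : i ∈ T) + (U)` (Leibniz with the tree's
  `Resolution.hasseDeriv_monomial`: `D^{(β)}x^m = C·x^{m−β}`, in `(x_T)` unless `β = m`, and then `γ = 0`);
  `killT_hasseDeriv_monomialCoat_top`: `D^{(m)}(x^m·U) ≡ U` modulo `(x_T)`;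
* §2 **`not_inCoordinateScope_monomialCoat`** (`q ≥ 2`, any field): `Ū := U(x_T ↦ 0) ≠ 0`, `Ū(0) = 0`, `x_i ∤ Ū` for
  `i ∉ T` ⇒ `¬ InCoordinateScope q (x^m·U)` — the prime `ker(K[x] → K[x]/(g) ∘ (x_T ↦ 0))` for a prime factor `g` of `Ū`
  through the origin (as in the coat lemma, res-dim4-p-3's `IsolationCert.not_inCoordinateScope_of_prime`);
* §3 presented form `not_inCoordinateScope_monomialCoat_evalT` (three `coeffAt` facts about the `T`-free sublist, symbolic
  coefficients allowed) and the ACCEPTANCE **`loopD_leaf_blind`**: over EVERY field, `x₁x₄·(x₃² − x₂⁴)` is OUT of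
  coordinate scope at `q = 3` (no curve) — and its one-parameter cousin `loopD_leaf_family_blind (β)`:
  `x₁x₄·(x₃² + β x₂x₃ − x₂⁴)`.

OURS; counted 0.  bears_on: LADDER-RESOLUTION:D157-DOOR2 (res-dim4-pi · frame v4 scope column · ∀K blindness).  Supports
stmt-ResolutionOfSingularities-16155 (helper).
-/

set_option linter.dupNamespace false -- mandated namespace of this single-conjunct summit

noncomputable section

open MvPolynomial Finset
open scoped BigOperators

namespace Summit.ResolutionOfSingularities.ResolutionOfSingularities.Theorems.PIDim4

namespace ScopeBlind

open Literature.AlgebraicGeometry.Resolution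
open StepKit

variable {K : Type} [Field K]

/-! ## §1 Hasse derivatives of a monomial coat -/

/-- a monomial with an exponent `d_i ≥ 1`, `i ∈ T`, lies in `(x_i : i ∈ T)`. [folklore] -/
theorem monomial_mem_span_X_of_apply_ne_zero (T : Finset (Fin 4)) {d : Fin 4 →₀ ℕ} {i : Fin 4} (hi : i ∈ T)
    (hdi : d i ≠ 0) (c : K) :
    monomial d c ∈ Ideal.span ((fun i => (X i : MvPolynomial (Fin 4) K)) '' (T : Set (Fin 4))) := by
  have h : monomial d c = monomial (d - Finsupp.single i 1) c * X i := by
    rw [X, monomial_mul, mul_one, Finsupp.sub_add_single_one_cancel hdi]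
  rw [h]
  exact Ideal.mul_mem_left _ _ (Ideal.subset_span ⟨i, hi, rfl⟩)

/-- **Hasse derivatives of a monomial coat**: for `|α| < q`, `|m| = q − 1` and `supp m ⊆ T`,
`D^{(α)}(x^m·U) ∈ (x_i : i ∈ T) ⊔ (U)`. [cite: EGAIV4, Thm. 16.11.2 (Leibniz rule (16.11.2.2))] -/
theorem hasseDeriv_monomialCoat_mem {q : ℕ} (T : Finset (Fin 4)) {m : Fin 4 →₀ ℕ} (hmT : ∀ i, i ∉ T → m i = 0)
    (hmdeg : m.degree = q - 1) (U : MvPolynomial (Fin 4) K) {α : Fin 4 →₀ ℕ} (hαq : α.degree < q) :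
    hasseDeriv α (monomial m (1 : K) * U) ∈
      Ideal.span ((fun i => (X i : MvPolynomial (Fin 4) K)) '' (T : Set (Fin 4))) ⊔ Ideal.span {U} := by
  classical
  rw [Equimultiple.hasseDeriv_eq, Literature.AlgebraicGeometry.Resolution.hasseDeriv_mul]
  refine Ideal.sum_mem _ fun p hp => ?_
  rw [Finset.HasAntidiagonal.mem_antidiagonal] at hp
  rw [Literature.AlgebraicGeometry.Resolution.hasseDeriv_monomial]
  by_cases hmb : m - p.1 = 0
  · by_cases hβ : p.1 = m
    · -- the top term: `γ = 0`, a multiple of `U`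
      have hγ : p.2 = 0 := by
        have hdeg : (p.1).degree + (p.2).degree = α.degree := by rw [← map_add, hp]
        rw [hβ, hmdeg] at hdeg
        have h2 : (p.2).degree = 0 := by omega
        exact (Finsupp.degree_eq_zero_iff _).mp h2
      rw [hγ, Literature.AlgebraicGeometry.Resolution.hasseDeriv_zero_apply]
      exact Ideal.mem_sup_right (Ideal.mul_mem_left _ _ (Ideal.subset_span rfl))
    · -- `m ≤ β`, `β ≠ m`: some binomial vanishes
      have hle : m ≤ p.1 := tsub_eq_zero_iff_le.mp hmb
      obtain ⟨i, hi⟩ : ∃ i, m i < p.1 i := by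
        by_contra h
        push Not at h
        exact hβ (le_antisymm (fun j => h j) hle)
      have hi' : i ∈ (p.1).support := Finsupp.mem_support_iff.mpr (by omega)
      rw [Finset.prod_eq_zero hi' (Nat.choose_eq_zero_of_lt hi), Nat.cast_zero, zero_mul, zero_mul]
      exact Ideal.zero_mem _
  · -- `x^{m−β} ≠ 1` has a coordinate from `T`
    obtain ⟨i, hi⟩ : ∃ i, (m - p.1) i ≠ 0 := by
      by_contra h
      push Not at h
      exact hmb (Finsupp.ext h)
    have hiT : i ∈ T := by
      by_contra hiT
      rw [Finsupp.tsub_apply, hmT i hiT, Nat.zero_sub] at hi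
      exact hi rfl
    exact Ideal.mem_sup_left (Ideal.mul_mem_right _ _
      (Ideal.mul_mem_left _ _ (monomial_mem_span_X_of_apply_ne_zero T hiT hi 1)))

/-! ### the substitution `x_T ↦ 0` -/

/-- `x_T ↦ 0` kills `x_i`, `i ∈ T`. [folklore] -/
theorem aeval_killT_X_mem {T : Finset (Fin 4)} {i : Fin 4} (hi : i ∈ T) :
    MvPolynomial.aeval (R := K) (fun i : Fin 4 => if i ∈ T then (0 : MvPolynomial (Fin 4) K) else X i)
      (X i : MvPolynomial (Fin 4) K) = 0 := by
  rw [MvPolynomial.aeval_X, if_pos hi]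

/-- `x_T ↦ 0` fixes `x_i`, `i ∉ T`. [folklore] -/
theorem aeval_killT_X_not_mem {T : Finset (Fin 4)} {i : Fin 4} (hi : i ∉ T) :
    MvPolynomial.aeval (R := K) (fun i : Fin 4 => if i ∈ T then (0 : MvPolynomial (Fin 4) K) else X i)
      (X i : MvPolynomial (Fin 4) K) = X i := by
  rw [MvPolynomial.aeval_X, if_neg hi]

/-- `x_T ↦ 0` kills the ideal `(x_i : i ∈ T)`. [folklore] -/
theorem aeval_killT_eq_zero_of_mem_span (T : Finset (Fin 4)) {f : MvPolynomial (Fin 4) K}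
    (hf : f ∈ Ideal.span ((fun i => (X i : MvPolynomial (Fin 4) K)) '' (T : Set (Fin 4)))) :
    MvPolynomial.aeval (R := K) (fun i : Fin 4 => if i ∈ T then (0 : MvPolynomial (Fin 4) K) else X i) f = 0 := by
  have hle : Ideal.span ((fun i => (X i : MvPolynomial (Fin 4) K)) '' (T : Set (Fin 4))) ≤
      RingHom.ker (MvPolynomial.aeval (R := K)
        (fun i : Fin 4 => if i ∈ T then (0 : MvPolynomial (Fin 4) K) else X i)).toRingHom := by
    rw [Ideal.span_le]
    rintro _ ⟨i, hi, rfl⟩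
    rw [SetLike.mem_coe, RingHom.mem_ker]
    exact aeval_killT_X_mem hi
  exact hle hf

/-- evaluation at the origin does not see `x_T ↦ 0`. [folklore] -/
theorem eval_zero_aeval_killT (T : Finset (Fin 4)) (f : MvPolynomial (Fin 4) K) :
    MvPolynomial.eval (0 : Fin 4 → K)
        (MvPolynomial.aeval (R := K) (fun i : Fin 4 => if i ∈ T then (0 : MvPolynomial (Fin 4) K) else X i) f) =
      MvPolynomial.eval (0 : Fin 4 → K) f := by
  have h : (MvPolynomial.eval (0 : Fin 4 → K)).comp
      (MvPolynomial.aeval (R := K) (fun i : Fin 4 => if i ∈ T then (0 : MvPolynomial (Fin 4) K) else X i)).toRingHom =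
        MvPolynomial.eval (0 : Fin 4 → K) := by
    refine MvPolynomial.ringHom_ext (fun r => ?_) (fun i => ?_)
    · simp
    · simp only [RingHom.comp_apply, AlgHom.toRingHom_eq_coe, AlgHom.coe_toRingHom, MvPolynomial.aeval_X,
        eval_X, Pi.zero_apply]
      split_ifs <;> simp
  exact congrArg (fun φ : MvPolynomial (Fin 4) K →+* K => φ f) h

/-- `x_T ↦ 0` on a monomial: kept iff no coordinate of `T` occurs. [folklore] -/
theorem aeval_killT_monomial (T : Finset (Fin 4)) (d : Fin 4 →₀ ℕ) (c : K) :
    MvPolynomial.aeval (R := K) (fun i : Fin 4 => if i ∈ T then (0 : MvPolynomial (Fin 4) K) else X i) (monomial d c) =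
      if ∀ i ∈ T, d i = 0 then monomial d c else 0 := by
  classical
  rw [← expo_coe d, monomial_expo_eq, map_mul, MvPolynomial.algHom_C, MvPolynomial.algebraMap_eq, map_prod]
  simp only [map_pow, MvPolynomial.aeval_X]
  split_ifs with h
  · congr 1
    refine Finset.prod_congr rfl fun i _ => ?_
    by_cases hiT : i ∈ T
    · rw [if_pos hiT, show (⇑d) i = 0 from h i hiT, pow_zero, pow_zero]
    · rw [if_neg hiT]
  · push Not at h
    obtain ⟨i, hiT, hdi⟩ := h
    rw [Finset.prod_eq_zero (Finset.mem_univ i) (by rw [if_pos hiT]; exact zero_pow hdi), mul_zero]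

/-- **`D^{(m)}(x^m·U) ≡ U (mod x_T)`**. [cite: EGAIV4, Thm. 16.11.2 (16.11.2.2)] -/
theorem killT_hasseDeriv_monomialCoat_top (T : Finset (Fin 4)) {m : Fin 4 →₀ ℕ} (hmT : ∀ i, i ∉ T → m i = 0)
    (U : MvPolynomial (Fin 4) K) :
    MvPolynomial.aeval (R := K) (fun i : Fin 4 => if i ∈ T then (0 : MvPolynomial (Fin 4) K) else X i)
        (hasseDeriv m (monomial m (1 : K) * U)) =
      MvPolynomial.aeval (R := K) (fun i : Fin 4 => if i ∈ T then (0 : MvPolynomial (Fin 4) K) else X i) U := by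
  classical
  set κ := MvPolynomial.aeval (R := K) (fun i : Fin 4 => if i ∈ T then (0 : MvPolynomial (Fin 4) K) else X i)
    with hκ
  rw [Equimultiple.hasseDeriv_eq, Literature.AlgebraicGeometry.Resolution.hasseDeriv_mul, map_sum]
  rw [Finset.sum_eq_single (m, (0 : Fin 4 →₀ ℕ))]
  · dsimp only
    rw [Literature.AlgebraicGeometry.Resolution.hasseDeriv_zero_apply,
      Literature.AlgebraicGeometry.Resolution.hasseDeriv_monomial, tsub_self,
      Finset.prod_congr rfl (fun i _ => Nat.choose_self (m i)), Finset.prod_const_one, Nat.cast_one, one_mul, map_mul,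
      hκ, aeval_killT_monomial, if_pos (show ∀ i ∈ T, (0 : Fin 4 →₀ ℕ) i = 0 from fun i _ => rfl), monomial_zero',
      C_1, one_mul]
  · rintro ⟨β, γ⟩ hp hne
    rw [Finset.HasAntidiagonal.mem_antidiagonal] at hp
    dsimp only at hp ⊢
    rw [Literature.AlgebraicGeometry.Resolution.hasseDeriv_monomial, map_mul, map_mul, map_natCast, hκ,
      aeval_killT_monomial]
    have hle : β ≤ m := by rw [← hp]; exact le_self_add
    by_cases hβ : β = m
    · exfalso
      apply hne
      have hγ : γ = 0 := add_left_cancel (a := β) (by rw [hp, hβ, add_zero])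
      rw [hβ, hγ]
    · obtain ⟨i, hi⟩ : ∃ i, (m - β) i ≠ 0 := by
        by_contra h
        push Not at h
        exact hβ (le_antisymm hle (tsub_eq_zero_iff_le.mp (Finsupp.ext h)))
      have hiT : i ∈ T := by
        by_contra hiT
        rw [Finsupp.tsub_apply, hmT i hiT, Nat.zero_sub] at hi
        exact hi rfl
      rw [if_neg (fun h => hi (h i hiT)), mul_zero, zero_mul]
  · intro h
    exact absurd (Finset.HasAntidiagonal.mem_antidiagonal.mpr (add_zero _)) h

/-! ## §2 The monomial-coat lemma -/

/-- **THE MONOMIAL-COAT LEMMA.**  Let `F = x^m · U` with `|m| = q − 1 ≥ 1`, `supp m ⊆ T`, and `Ū = U(x_T ↦ 0)`.  If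
`Ū ≠ 0`, `Ū(0) = 0`, and no `x_i` (`i ∉ T`) divides `Ū`, then `F` is OUT of coordinate scope: the `q`-fold locus has the
non-coordinate component `{x_T = 0, g = 0}` through the origin, `g` a prime factor of `Ū` vanishing there.  Curve-free,
every field. OURS. [cite: AtiyahMacdonald1969, Ch. 1 (prime ideals; minimal primes, Ex. 1.8)] -/
theorem not_inCoordinateScope_monomialCoat {q : ℕ} (hq : 2 ≤ q) (T : Finset (Fin 4)) {m : Fin 4 →₀ ℕ}
    (hmT : ∀ i, i ∉ T → m i = 0) (hmdeg : m.degree = q - 1) (U : MvPolynomial (Fin 4) K)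
    (hne : MvPolynomial.aeval (R := K) (fun i : Fin 4 => if i ∈ T then (0 : MvPolynomial (Fin 4) K) else X i) U ≠ 0)
    (h0 : MvPolynomial.eval (0 : Fin 4 → K) U = 0)
    (hX : ∀ i : Fin 4, i ∉ T →
      ¬ ((X i : MvPolynomial (Fin 4) K) ∣
        MvPolynomial.aeval (R := K) (fun i : Fin 4 => if i ∈ T then (0 : MvPolynomial (Fin 4) K) else X i) U)) :
    ¬ InCoordinateScope q (monomial m (1 : K) * U) := by
  classical
  set κ := MvPolynomial.aeval (R := K) (fun i : Fin 4 => if i ∈ T then (0 : MvPolynomial (Fin 4) K) else X i)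
    with hκ
  have hε : MvPolynomial.eval (0 : Fin 4 → K) (κ U) = 0 := by rw [hκ, eval_zero_aeval_killT]; exact h0
  obtain ⟨g, hg, hgU, hg0⟩ := exists_prime_dvd_eval_zero hne hε
  let I : Ideal (MvPolynomial (Fin 4) K) := Ideal.span {g}
  haveI hI : I.IsPrime := (Ideal.span_singleton_prime hg.ne_zero).mpr hg
  let φ : MvPolynomial (Fin 4) K →+* MvPolynomial (Fin 4) K ⧸ I := (Ideal.Quotient.mk I).comp κ.toRingHom
  have hφ : ∀ f, φ f = Ideal.Quotient.mk I (κ f) := fun f => rfl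
  refine IsolationCert.not_inCoordinateScope_of_prime (P := RingHom.ker φ) (RingHom.ker_isPrime φ) ?_ ?_ T ?_ ?_
  · -- `J ≤ (x_T) + (U) ≤ ker φ`
    unfold singLocusIdeal
    rw [Ideal.span_le]
    rintro _ ⟨α, -, hαq, rfl⟩
    have hmem := hasseDeriv_monomialCoat_mem T hmT hmdeg U hαq
    have hle : Ideal.span ((fun i => (X i : MvPolynomial (Fin 4) K)) '' (T : Set (Fin 4))) ⊔ Ideal.span {U} ≤
        RingHom.ker φ := by
      refine sup_le ?_ ?_
      · rw [Ideal.span_le]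
        rintro _ ⟨i, hi, rfl⟩
        rw [SetLike.mem_coe, RingHom.mem_ker, hφ, hκ, aeval_killT_X_mem hi, map_zero]
      · rw [Ideal.span_le, Set.singleton_subset_iff, SetLike.mem_coe, RingHom.mem_ker, hφ]
        exact Ideal.Quotient.eq_zero_iff_mem.mpr (Ideal.mem_span_singleton.mpr hgU)
    exact hle hmem
  · -- `ker φ ≤ 𝔪₀`
    intro f hf
    rw [RingHom.mem_ker, hφ] at hf
    obtain ⟨h, hh⟩ := Ideal.mem_span_singleton'.mp (Ideal.Quotient.eq_zero_iff_mem.mp hf)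
    unfold originIdeal
    rw [RingHom.mem_ker, ← eval_zero_aeval_killT T f, ← hκ, ← hh, map_mul, hg0, mul_zero]
  · -- no `x_i`, `i ∉ T`, in `ker φ`
    intro i hi
    by_contra hiT
    rw [RingHom.mem_ker, hφ, hκ, aeval_killT_X_not_mem hiT] at hi
    have hgX : g ∣ (X i : MvPolynomial (Fin 4) K) :=
      Ideal.mem_span_singleton.mp (Ideal.Quotient.eq_zero_iff_mem.mp hi)
    have hass : Associated g (X i) := hg.irreducible.associated_of_dvd MvPolynomial.X_prime.irreducible hgX
    exact hX i hiT (hass.dvd_iff_dvd_left.mp hgU)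
  · -- `J ⊄ (x_T)`: apply `x_T ↦ 0` to the top derivative
    intro hle
    have hq1 : 0 < m.degree := by rw [hmdeg]; omega
    have hq2 : m.degree < q := by rw [hmdeg]; omega
    have hD : hasseDeriv m (monomial m (1 : K) * U) ∈ singLocusIdeal q (monomial m (1 : K) * U) :=
      Ideal.subset_span ⟨m, hq1, hq2, rfl⟩
    have hk := aeval_killT_eq_zero_of_mem_span T (hle hD)
    rw [killT_hasseDeriv_monomialCoat_top T hmT U] at hk
    exact hne hk

/-! ## §3 Presented form and the LOOP-D leaf -/

/-- `x_T ↦ 0` on a presented polynomial keeps the terms free of `T`. [folklore] -/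
theorem aeval_killT_evalT (T : Finset (Fin 4)) (L : Terms 4 K) :
    MvPolynomial.aeval (R := K) (fun i : Fin 4 => if i ∈ T then (0 : MvPolynomial (Fin 4) K) else X i) (evalT L) =
      evalT (L.filter fun t => ∀ i ∈ T, t.1 i = 0) := by
  classical
  induction L with
  | nil => simp
  | cons t L ih =>
    rw [evalT_cons, map_add, ih, aeval_killT_monomial]
    by_cases h : ∀ i ∈ T, t.1 i = 0
    · have h' : ∀ i ∈ T, (expo t.1) i = 0 := fun i hi => by rw [expo_apply]; exact h i hi
      rw [if_pos h', List.filter_cons_of_pos (by simpa using h), evalT_cons]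
    · have h' : ¬ ∀ i ∈ T, (expo t.1) i = 0 := fun h'' => h fun i hi => by
        have := h'' i hi; rwa [expo_apply] at this
      rw [if_neg h', zero_add, List.filter_cons_of_neg (by simp [h])]

/-- **the monomial-coat lemma on a presented `U`** (symbolic coefficients allowed): three `coeffAt` facts about the
`T`-free sublist. [folklore] -/
theorem not_inCoordinateScope_monomialCoat_evalT {q : ℕ} (hq : 2 ≤ q) (T : Finset (Fin 4)) {m : Fin 4 →₀ ℕ}
    (hmT : ∀ i, i ∉ T → m i = 0) (hmdeg : m.degree = q - 1) (LU : Terms 4 K) {e₀ : Fin 4 → ℕ}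
    (hne : coeffAt (LU.filter fun t => ∀ i ∈ T, t.1 i = 0) e₀ ≠ 0)
    (h0 : coeffAt (LU.filter fun t => ∀ i ∈ T, t.1 i = 0) 0 = 0)
    (hX : ∀ i : Fin 4, i ∉ T → ∃ e : Fin 4 → ℕ, e i = 0 ∧ coeffAt (LU.filter fun t => ∀ i ∈ T, t.1 i = 0) e ≠ 0) :
    ¬ InCoordinateScope q (monomial m (1 : K) * evalT LU) := by
  classical
  refine not_inCoordinateScope_monomialCoat hq T hmT hmdeg (evalT LU) ?_ ?_ ?_
  · rw [aeval_killT_evalT]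
    exact evalT_ne_zero_of_coeffAt hne
  · rw [← eval_zero_aeval_killT T, aeval_killT_evalT, eval_zero_evalT_eq_coeffAt, h0]
  · intro i hiT
    obtain ⟨e, hei, he⟩ := hX i hiT
    rw [aeval_killT_evalT]
    exact not_X_dvd_evalT_of_coeffAt hei he

/-- the LOOP-D leaf family `x₃² + β x₂x₃ − x₂⁴` as a term list. -/
theorem evalT_loopDU (β : K) :
    evalT ([(![0, 0, 2, 0], 1), (![0, 1, 1, 0], β), (![0, 4, 0, 0], -1)] : Terms 4 K) =
      X 2 ^ 2 + C β * (X 1 * X 2) - X 1 ^ 4 := by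
  simp only [evalT_cons, evalT_nil, monomial_expo_eq, Fin.prod_univ_four, add_zero]
  simp
  ring

/-- `x₁x₄` as a monomial. -/
theorem monomial_x1x4 : monomial (expo ![1, 0, 0, 1]) (1 : K) = X 0 * X 3 := by
  rw [monomial_expo_eq, C_1, one_mul, Fin.prod_univ_four]
  simp

/-- **the LOOP-D leaf family is blind for every `β` over every field**: `x₁x₄·(x₃² + β x₂x₃ − x₂⁴)` is OUT of coordinate
scope at `q = 3` (monomial coat `x₁x₄`, `T = {x₁, x₄}`; `Ū = U` has the monomials `x₃²` and `−x₂⁴`). [OURS · instance] -/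
theorem loopD_leaf_family_blind (β : K) :
    ¬ InCoordinateScope 3 ((X 0 * X 3 : MvPolynomial (Fin 4) K) * (X 2 ^ 2 + C β * (X 1 * X 2) - X 1 ^ 4)) := by
  classical
  have h := not_inCoordinateScope_monomialCoat_evalT (K := K) (q := 3) (by norm_num) {0, 3} (m := expo ![1, 0, 0, 1])
    (fun i hi => by fin_cases i <;> simp_all) (by rw [degree_expo]; decide)
    ([(![0, 0, 2, 0], 1), (![0, 1, 1, 0], β), (![0, 4, 0, 0], -1)] : Terms 4 K) (e₀ := ![0, 0, 2, 0])
    (by simp [coeffAt]) (by simp [coeffAt]) (by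
      intro i hi
      fin_cases i
      · simp at hi
      · exact ⟨![0, 0, 2, 0], rfl, by simp [coeffAt]⟩
      · exact ⟨![0, 4, 0, 0], rfl, by simp [coeffAt]⟩
      · simp at hi)
  rwa [evalT_loopDU, monomial_x1x4] at h

/-- **res-dim4-p-6 g3's LOOP-D leaf `x₁x₄·(x₃² − x₂⁴)` is OUT of coordinate scope over every field** (`β = 0`; p-6 g3
certified it by the monomial curve `(0, s, s², 0)` — here no curve). [OURS · instance] -/
theorem loopD_leaf_blind :
    ¬ InCoordinateScope 3 ((X 0 * X 3 : MvPolynomial (Fin 4) K) * (X 2 ^ 2 - X 1 ^ 4)) := by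
  have h := loopD_leaf_family_blind (K := K) 0
  rwa [map_zero, zero_mul, add_zero] at h

end ScopeBlind

end Summit.ResolutionOfSingularities.ResolutionOfSingularities.Theorems.PIDim4

end
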